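import Literature.Probability.LatticeModels.CriticalFKIsingConnectionLawsBox
import Summits.CriticalPhenomena.Ising3DConformalLimit.Theorems.ArmDressingArmDressingGlueDefs
import HarnessLib

/-!
# Route `ArmDressing`, crux `ArmDressingGlue` (stmt-CriticalPhenomena-15700):
# stub `stub_wiredBoxLimit`

Clause (a) of the support `InfiniteVolumeEdwardsSokal` of the route, in the vocabulary of
`ArmDressingArmDressingGlueDefs`: for every finite family `K` of lattice sets whose infinite members
pairwise intersect and every set `R` of relations, the wired critical FK-Ising box probabilities
`PrL m K R L = φ¹_{Λ_L, p_c, 2}(open-connection relation of K ∈ R)` converge as `L → ∞`, so that the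
route's `Pr m K R = limUnder atTop (PrL m K R)` is a genuine limit.

The mathematics is the Literature theorem
`Literature.Probability.LatticeModels.tendsto_rcMeasure_real_connRelLaw_criticalBeta_of_inter`
(`CriticalFKIsingConnectionLawsBox`): Grimmett 2006, Thm. (4.19) (weak limit of the wired box
measures, via monotonicity in the domain and FKG) for the finite truncations `K i ∩ Λ_N` of the
probes, plus the vanishing of the truncation error — a wired arm probability `φ¹_{Λ_N}(x ↔ ∂Λ_N)`,
which tends to `0` at `p_c(2)` on `ℤ³` because
`φ¹_{Λ_{n+1}}(0 ↔ ∂) = ⟨σ_0⟩⁺_{Λ_n; β_c} → m*(β_c) = 0` (Edwards–Sokal with wired/plus boundary;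
Aizenman–Duminil-Copin–Sidoravicius 2015). The route's
`μ L = rcMeasure (boxGraph 3 L) … (boxBoundary 3 L)` is definitionally the general wired measure
`rcMeasure (finsetGraph (zdGraph 3) (box 3 L)) … (wiredBoundary (zdGraph 3) (box 3 L))` of the
Literature files (`boxGraph_eq_finsetGraph`, `boxBoundary_eq_wiredBoundary` are `rfl`).

References: G. Grimmett, *The Random-Cluster Model* (2006), Thm. (4.19), Prop. (5.11);
M. Aizenman, H. Duminil-Copin, V. Sidoravicius, Comm. Math. Phys. 334 (2015), Thm. 1.2.
-/

noncomputable section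

namespace Summit.CriticalPhenomena.Ising3DConformalLimit.Cruxes.ArmDressingGlue.WiredBoxLimitProof

open Summit.CriticalPhenomena.Ising3DConformalLimit.Cruxes.ArmDressingGlue.Vocab
open Filter Literature.Probability.LatticeModels

/-- **Clause (a) of the support ES** (registered stub `stub_wiredBoxLimit` of the skeleton of
`ArmDressingGlue`): for every `m`, every family `K : Fin m → Set (Site 3)` whose infinite members
pairwise intersect and every `R`, the wired critical FK-Ising box probabilities `PrL m K R L`
converge as `L → ∞` (Grimmett 2006, Thm. (4.19) and Prop. (5.11); the wired arm vanishes at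
`p_c(2)` on `ℤ³` by Aizenman–Duminil-Copin–Sidoravicius 2015). [cite: Grimmett2006, Thm. (4.19)] -/
theorem stub_wiredBoxLimit : WiredBoxLimit := by
  intro m K R hK
  exact tendsto_rcMeasure_real_connRelLaw_criticalBeta_of_inter (d := 3) le_rfl hK R

end Summit.CriticalPhenomena.Ising3DConformalLimit.Cruxes.ArmDressingGlue.WiredBoxLimitProof

end
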